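import Summits.QuantumFields.YangMills.Theorems.BalabanUVNodesN11GaussianCertificateRows
import Summits.QuantumFields.YangMills.Theorems.BalabanUVNodesN11NoExpansionTStepAtRePinH
import Summits.QuantumFields.YangMills.Theorems.BalabanUVNodesN11Sect3SupplySplice

/-!
# DAG node N11 — WHERE THE NO-EXPANSION 𝐓-STEP STANDS AT A GAUSSIAN CERTIFICATE (the class of `…N11GaussianCertificateRows`): dag-n11-e's `…N11NoExpansionTStepAtRePinH` with its (K0b) A-fibre
# domination rows GONE — `NoExpansionTStepAt θ p k` and THEOREM 1 of [III] (all levels, live line ∕ at the Gaussian door of the cured witness of record) from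
# def-T's operand rows + [III] §3's supply, AND NOTHING ELSE

HEADER — WORK-UNIT METADATA.  Cell `pub-ymgap`, YM-PLAN Track A (D-0062 ∕ D-0149 width seats), seat `pub-ymgap-dag-n11-w1` (g0; WIDTH SEAT 1 of 4 on NODE n11 [B14]),
route `BalabanUVNodes` rev 25, item K1⁷ `StabilityBAtRecordR13SepCoPH` = stmt-QuantumFields-20542 (helper, `--kind proof --supports 20542 --as helper`, count-neutral).
[III] = [Balaban1988Convergent], [IV] = [Balaban1989LargeFieldI].  The Gaussian twin of dag-n11-e g14's `…N11NoExpansionTStepAtRePinH` (★★ `noExpansionTStepAt_rePinH_of_dominated_rows[_at_present_parents]`,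
★★★ `sLaw₁₃CoPH_all_rePinH_…`), over this seat's `…N11GaussianCertificateRows` (the class: `hζ` certificate `ζ0`, `hq` A-fibre Gaussian `quad`;
`exists_local_witness_clause_succ_of_sLaw₁₃CoPH_of_gaussCert`), dag-n11-e's `…ThmP245OfSect3SupplyCoPH` (`sLaw₁₃CoPH_all_of_tStep_of_supply_of_liveSel`, `sLaw₁₃CoPH_all_theta13LiveOfRecordH_of_tStep_of_supply`)
and `…Sect3SupplyPresentParents` (`slotsTOfRecord₁₃H_succ_eq_zero_of_init_eq_zero`).

WHY THIS FILE.  At dag-n11-d's certificate `rePinH θ` (`quad ≡ 0`) the no-expansion 𝐓-step needs, per no-expansion history, node00-def-K0b's A-fibre domination rows — FALSE at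
every thin region (this seat's `…N11AFibreDominationRow` §3).  At the Gaussian certificate `gaussPinH θ` (same `ζ0`, A-fibre Gaussian `quad`) those rows are THEOREMS
(`…N11GaussianCertificateRows`), so the same deliverables need def-T's operand rows ONLY.  This file states them in dag-n11-e's format, rows asked only at PRESENT parents,
HYPOTHESIS-KEYED on the class (the named witness `gaussPinH` of `…N11GaussianCertificateDefs` instantiates them by `rfl`).

WHAT THIS FILE PROVES (0 `sorry`, 0 `def`; nothing of Bałaban asserted).  §1 ★★ `noExpansionTStepAt_of_gaussCert_of_operandRows_at_present_parents` (the operand rows owed only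
where `ρ_k(init s′) ≢ 0`).  §2 ★★★ `sLaw₁₃CoPH_all_of_gaussCert_of_operandRows_of_supply_of_liveSel` (THEOREM 1 at any θ of the class, all levels, on the live-selector line of `θ`, from the
operand rows + [III] §3's supply) · ★★★ `sLaw₁₃CoPH_all_gaussCertH_doorCured_theta13LiveOfRecord_of_operandRows_of_supply` — THE HONEST STATE OF N11 AT ANY GAUSSIAN-CLASS
H-EXTENSION OF THE WITNESS OF RECORD: Theorem 1 of [III], ALL levels, ALL histories, from (per level, at present parents) def-T's operand rows + [III] §3's supply, AND NOTHING ELSE.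

HONEST FRAMING.  Count-neutral kernel composition; the operand rows (def-T ∕ dag-n11-d (d4)) and [III] §3's supply (dag-n11-e's splice, nobody's theorem) stay DISPLAYED;
a Gaussian certificate carries a RANGE value of `quad` (serves the no-expansion analysis only — dag-n11-w4's caveat), NOT K0b's value of record; nothing of Bałaban asserted.  N11 NOT
discharged; K1⁷ NOT closed; counts unmoved (typed 28∕28 · discharged 5∕27).  One finite `𝕋⁴_{L^K}` programme at fixed `ε = L^{−K}`; R4 closes only the conditional
finite-𝕋⁴ rung `BalabanLadder.UV` — NOT ℝ⁴, NOT OS, NOT a mass gap, NOT Clay.  No `sorry`, `axiom`, `instance`, `notation`.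
Sources: [III] Theorem p.245, Thm 1 p.262, p.244, (3.24)–(3.25) p.270, (3.23) p.270, (2.17)–(2.18) p.257, (2.23) p.258; [IV] (0.2)–(0.4) p.176, p.177 (i)–(ii).
-/

noncomputable section

open MeasureTheory
open scoped BigOperators ENNReal NNReal Matrix.Norms.L2Operator

namespace Summit.QuantumFields.YangMills.Theorems.BalabanUVNodesN11NoExpansionTStepAtGaussCert

open Literature.MathematicalPhysics.QuantumFieldTheory.Balaban1983to89 T4Continuum Node00 Node00.Tk DagBinding
open BalabanUVNodesN11FluctTruncationDefs (IsFluctLocal)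
open BalabanUVNodesN11Sect3SupplyDefs (NoExpansionTStepAt Sect3SupplyAt)
open BalabanUVNodesN11Sect3SupplyPresentParents (slotsTOfRecord₁₃H_succ_eq_zero_of_init_eq_zero)
open BalabanUVNodesN11ThmP245OfSect3SupplyCoPH (sLaw₁₃CoPH_all_of_tStep_of_supply_of_liveSel sLaw₁₃CoPH_all_theta13LiveOfRecordH_of_tStep_of_supply)
open BalabanUVNodesN11HistoryPinnedResidualDefs (ZhPinOfRecord₁₃)
open B10Eq42TorusConstraint (bondsIn)
open B15DeterminingSets (MSField)
open BalabanUVNodesN11GaussianCertificateRows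

variable {F : T4Family} {N : ℕ} [NeZero N]
variable (θ : Stage13HParams F N) (p : B12.RunParams)

/-! ## §1. `NoExpansionTStepAt θ p k` for the Gaussian class from def-T's operand rows at PRESENT parents only -/

/-- **★★ THE NO-EXPANSION 𝐓-STEP FOR THE GAUSSIAN CLASS, THE OPERAND ROWS ASKED ONLY AT PRESENT PARENTS**: if `ρ_k(init s′) ≡ 0` the 𝐓-image slot at `s′` is the zero
density (dag-n11-e's `slotsTOfRecord₁₃H_succ_eq_zero_of_init_eq_zero`) and the clause holds by its zero disjunct; elsewhere the class theorem
`exists_local_witness_clause_succ_of_sLaw₁₃CoPH_of_gaussCert` with def-T's two operand rows.  NO (K0b) row (contrast `noExpansionTStepAt_rePinH_of_dominated_rows_at_present_parents`).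
[cite: Balaban1988Convergent, Theorem p.245, (3.1) p.264, (3.24)–(3.25) p.270, (3.23) p.270, (2.23) p.258] -/
theorem noExpansionTStepAt_of_gaussCert_of_operandRows_at_present_parents (hζ : ∀ (p : B12.RunParams) (n : ℕ) (Ω Λ : ℕ → Set (Site (F.P p.K) 0)), (θ.Zh p n Ω Λ).ζ0 = (ZhPinOfRecord₁₃ θ.toStage13Params p Ω Λ).ζ0)
    (hq : ∀ (p : B12.RunParams) (n : ℕ) (Ω Λ : ℕ → Set (Site (F.P p.K) 0)) (j : ℕ) (Λ' : Set (Site (F.P p.K) 0)) (ω : MultiCfg (F.P p.K) (SU N) (FluctV N)),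
      (θ.Zh p n Ω Λ).quad j Λ' ω = ∑ b ∈ (Set.toFinite (bondsIn j (Λ'ᶜ ∩ Ω (j + 1)))).toFinset, ‖(ω j).2 b‖ ^ 2)
    (h : θ.Provisos₁₃CoPH F N) {k : ℕ} (hk : k < p.K) (hM : 1 ≤ θ.τ9.M)
    (hops : ∀ (t : SeqOfRecord F θ.ν θ.τ9.M (gOfRecord₁₃ F N θ.toStage13Params p) p.K k → Sect2.TermValues (F.P p.K) (MatA N) (FluctV N) θ.τ9.M)
      (Ek : SeqOfRecord F θ.ν θ.τ9.M (gOfRecord₁₃ F N θ.toStage13Params p) p.K k → ℝ),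
      HasSect2FormAtZS F N (FluctV N) p.K (settingOfRecord₁₃ F N θ.toStage13Params p) k (θ.rzAt p) (WtOfRecord₁₃H F N θ p)
        (UbgOfRecord₁₃CoP F N θ.toStage13Params p k)
        (fun s u => Sect2.LawsRT (sect2TowerOfRecord F N (FluctV N) p.K (settingOfRecord₁₃ F N θ.toStage13Params p) (θ.rzAt p s) s u)
          (settingOfRecord₁₃ F N θ.toStage13Params p).lf k)
        (slotsOfRecord F N θ.ν θ.τ9 (EOfRecord₁₃ F N θ.toStage13Params) (wOfRecord₉ F N θ.toStage9Params) θ.ppSel p (gOfRecord₁₃ F N θ.toStage13Params p) k) t Ek →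
      (∀ s₀, IsFluctLocal k (t s₀)) →
      ∀ s : SeqOfRecord F θ.ν θ.τ9.M (gOfRecord₁₃ F N θ.toStage13Params p) p.K (k + 1), s.Ω (k + 1) = ∅ →
        slotsOfRecord F N θ.ν θ.τ9 (EOfRecord₁₃ F N θ.toStage13Params) (wOfRecord₉ F N θ.toStage9Params) θ.ppSel p (gOfRecord₁₃ F N θ.toStage13Params p) k s.init ≠ 0 →
        ∀ S ∈ admSOfRecord F θ.ν θ.τ9.M (gOfRecord₁₃ F N θ.toStage13Params p) p.K k s.init,
          Measurable (fun ω : MultiCfg (F.P p.K) (SU N) (FluctV N) =>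
            sect2Operand F N (FluctV N) p.K (settingOfRecord₁₃ F N θ.toStage13Params p) (θ.rzAt p s.init) s.init (t s.init) (Ek s.init)
                (UbgOfRecord₁₃CoP F N θ.toStage13Params p k s.init) (S, fun j => (ω j).2) (fun j => (ω j).1)) ∧
          ∃ CΦ : ℝ, ∀ a U, sect2Operand F N (FluctV N) p.K (settingOfRecord₁₃ F N θ.toStage13Params p) (θ.rzAt p s.init) s.init (t s.init) (Ek s.init)
                (UbgOfRecord₁₃CoP F N θ.toStage13Params p k s.init) a U ≤ CΦ) :
    NoExpansionTStepAt θ p k := by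
  intro hS
  obtain ⟨t, Ek, hform, hloc, hstep⟩ := exists_local_witness_clause_succ_of_sLaw₁₃CoPH_of_gaussCert θ p hζ hq h hk hM hS
  refine ⟨t, Ek, hform, fun s hΩ => ?_⟩
  by_cases h0 : slotsOfRecord F N θ.ν θ.τ9 (EOfRecord₁₃ F N θ.toStage13Params) (wOfRecord₉ F N θ.toStage9Params) θ.ppSel p (gOfRecord₁₃ F N θ.toStage13Params p) k s.init = 0
  · exact Or.inl (slotsTOfRecord₁₃H_succ_eq_zero_of_init_eq_zero θ p s h0)
  · exact hstep s hΩ (hops t Ek hform hloc s hΩ h0)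


/-- **★★ THE SAME IN def-T's TERM-ROW GRAMMAR** (dag-n11-w4's `noExpansionTStepAt_of_coercive_termRows_at_present_parents` with pins, measurability and coercivity DISCHARGED
for the Gaussian class): `NoExpansionTStepAt θ p k` from the six term rows of the exposed witness at present parents ONLY.
[cite: Balaban1988Convergent, Theorem p.245, (3.1) p.264, (3.24)–(3.25) p.270, (2.27) p.259] -/
theorem noExpansionTStepAt_of_gaussCert_of_termRows_at_present_parents (hζ : ∀ (p : B12.RunParams) (n : ℕ) (Ω Λ : ℕ → Set (Site (F.P p.K) 0)), (θ.Zh p n Ω Λ).ζ0 = (ZhPinOfRecord₁₃ θ.toStage13Params p Ω Λ).ζ0)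
    (hq : ∀ (p : B12.RunParams) (n : ℕ) (Ω Λ : ℕ → Set (Site (F.P p.K) 0)) (j : ℕ) (Λ' : Set (Site (F.P p.K) 0)) (ω : MultiCfg (F.P p.K) (SU N) (FluctV N)),
      (θ.Zh p n Ω Λ).quad j Λ' ω = ∑ b ∈ (Set.toFinite (bondsIn j (Λ'ᶜ ∩ Ω (j + 1)))).toFinset, ‖(ω j).2 b‖ ^ 2)
    (h : θ.Provisos₁₃CoPH F N) {k : ℕ} (hk : k < p.K) (hM : 1 ≤ θ.τ9.M)
    (hterm : ∀ (t : SeqOfRecord F θ.ν θ.τ9.M (gOfRecord₁₃ F N θ.toStage13Params p) p.K k → Sect2.TermValues (F.P p.K) (MatA N) (FluctV N) θ.τ9.M)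
      (Ek : SeqOfRecord F θ.ν θ.τ9.M (gOfRecord₁₃ F N θ.toStage13Params p) p.K k → ℝ),
      HasSect2FormAtZS F N (FluctV N) p.K (settingOfRecord₁₃ F N θ.toStage13Params p) k (θ.rzAt p) (WtOfRecord₁₃H F N θ p)
        (UbgOfRecord₁₃CoP F N θ.toStage13Params p k)
        (fun s u => Sect2.LawsRT (sect2TowerOfRecord F N (FluctV N) p.K (settingOfRecord₁₃ F N θ.toStage13Params p) (θ.rzAt p s) s u)
          (settingOfRecord₁₃ F N θ.toStage13Params p).lf k)
        (slotsOfRecord F N θ.ν θ.τ9 (EOfRecord₁₃ F N θ.toStage13Params) (wOfRecord₉ F N θ.toStage9Params) θ.ppSel p (gOfRecord₁₃ F N θ.toStage13Params p) k) t Ek →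
      (∀ s₀, IsFluctLocal k (t s₀)) →
      ∀ s : SeqOfRecord F θ.ν θ.τ9.M (gOfRecord₁₃ F N θ.toStage13Params p) p.K (k + 1), s.Ω (k + 1) = ∅ →
        slotsOfRecord F N θ.ν θ.τ9 (EOfRecord₁₃ F N θ.toStage13Params) (wOfRecord₉ F N θ.toStage9Params) θ.ppSel p (gOfRecord₁₃ F N θ.toStage13Params p) k s.init ≠ 0 →
        (∀ (j : ℕ) (X : (Sect2.domSys (F.P p.K) θ.τ9.M j).Dom) (z : Site (F.P p.K) j) (g' : ℝ),
          Measurable (fun U : GaugeField (F.P p.K) 0 (SU N) => ((t s.init).E j X z g' (Sect2.ofBackgroundC (settingOfRecord₁₃ F N θ.toStage13Params p).ι U)).re)) ∧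
        (∀ (j : ℕ) (X : (Sect2.domSys (F.P p.K) θ.τ9.M j).Dom),
          Measurable (fun U : GaugeField (F.P p.K) 0 (SU N) => ((t s.init).R j X (Sect2.ofBackgroundC (settingOfRecord₁₃ F N θ.toStage13Params p).ι U)).re)) ∧
        (∀ (S' : ℕ → Set (Site (F.P p.K) 0)) (j : ℕ) (X : (Sect2.domSys (F.P p.K) θ.τ9.M j).Dom),
          Measurable (fun q : GaugeField (F.P p.K) 0 (SU N) × MSFluct (F.P p.K) (FluctV N) =>
            ((t s.init).B j X (Sect2.ofBackgroundC (settingOfRecord₁₃ F N θ.toStage13Params p).ι q.1) (S', q.2)).re)) ∧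
        (∃ CE : ℝ, ∀ (j : ℕ) (X : (Sect2.domSys (F.P p.K) θ.τ9.M j).Dom) (z : Site (F.P p.K) j) (g' : ℝ) (U : GaugeField (F.P p.K) 0 (SU N)),
          |((t s.init).E j X z g' (Sect2.ofBackgroundC (settingOfRecord₁₃ F N θ.toStage13Params p).ι U)).re| ≤ CE) ∧
        (∃ CR : ℝ, ∀ (j : ℕ) (X : (Sect2.domSys (F.P p.K) θ.τ9.M j).Dom) (U : GaugeField (F.P p.K) 0 (SU N)),
          |((t s.init).R j X (Sect2.ofBackgroundC (settingOfRecord₁₃ F N θ.toStage13Params p).ι U)).re| ≤ CR) ∧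
        (∃ CB : ℝ, ∀ (j : ℕ) (X : (Sect2.domSys (F.P p.K) θ.τ9.M j).Dom) (U : GaugeField (F.P p.K) 0 (SU N)) (a : Tk.SFluct (F.P p.K) (FluctV N)),
          |((t s.init).B j X (Sect2.ofBackgroundC (settingOfRecord₁₃ F N θ.toStage13Params p).ι U) a).re| ≤ CB)) :
    NoExpansionTStepAt θ p k := by
  intro hS
  obtain ⟨t, Ek, hform, hloc, hstep⟩ := exists_local_witness_clause_succ_of_sLaw₁₃CoPH_of_gaussCert_of_termRows θ p hζ hq h hk hM hS
  refine ⟨t, Ek, hform, fun s hΩ => ?_⟩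
  by_cases h0 : slotsOfRecord F N θ.ν θ.τ9 (EOfRecord₁₃ F N θ.toStage13Params) (wOfRecord₉ F N θ.toStage9Params) θ.ppSel p (gOfRecord₁₃ F N θ.toStage13Params p) k s.init = 0
  · exact Or.inl (slotsTOfRecord₁₃H_succ_eq_zero_of_init_eq_zero θ p s h0)
  · obtain ⟨hE, hR, hB, hEb, hRb, hBb⟩ := hterm t Ek hform hloc s hΩ h0
    exact hstep s hΩ hE hR hB hEb hRb hBb

/-! ## §2. THEOREM 1 at the Gaussian certificate from the operand rows and [III] §3's supply — nothing else -/

/-- **★★★ THEOREM 1 OF [III] AT ANY `θ` OF THE GAUSSIAN CLASS, ALL LEVELS, ALL HISTORIES, ON THE LIVE-SELECTOR LINE OF `θ`** (core provisos, selector clause, admissibility,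
`0 ≤ κ, E₀, B₀`, `1 ≤ M`): per level, def-T's operand rows at present parents + `Sect3SupplyAt θ p k` — NO (K0b) row.  The Gaussian
twin of dag-n11-e's `sLaw₁₃CoPH_all_rePinH_of_dominated_rows_of_supply_of_liveSel`.
[cite: Balaban1988Convergent, Thm 1 p.262, Theorem p.245, p.244, (3.24)–(3.25) p.270, (3.23) p.270; Balaban1989LargeFieldI, (0.2)–(0.4) p.176, p.177 (i)–(ii)] -/
theorem sLaw₁₃CoPH_all_of_gaussCert_of_operandRows_of_supply_of_liveSel (hζ : ∀ (p : B12.RunParams) (n : ℕ) (Ω Λ : ℕ → Set (Site (F.P p.K) 0)), (θ.Zh p n Ω Λ).ζ0 = (ZhPinOfRecord₁₃ θ.toStage13Params p Ω Λ).ζ0)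
    (hq : ∀ (p : B12.RunParams) (n : ℕ) (Ω Λ : ℕ → Set (Site (F.P p.K) 0)) (j : ℕ) (Λ' : Set (Site (F.P p.K) 0)) (ω : MultiCfg (F.P p.K) (SU N) (FluctV N)),
      (θ.Zh p n Ω Λ).quad j Λ' ω = ∑ b ∈ (Set.toFinite (bondsIn j (Λ'ᶜ ∩ Ω (j + 1)))).toFinset, ‖(ω j).2 b‖ ^ 2)
    (h : θ.Provisos₁₃CoPH F N)
    (hsel : θ.ppSel = ppSelLiveOfRecord F N θ.ν θ.τ9 (EOfRecord₁₃ F N θ.toStage13Params) (wOfRecord₉ F N θ.toStage9Params))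
    (hθ : θ.Admissible F N) (hκ : 0 ≤ θ.s2.lf.κ) (hE₀ : 0 ≤ θ.s2.lf.E₀) (hB₀ : 0 ≤ θ.s2.lf.B₀) (hM : 1 ≤ θ.τ9.M)
    (hops : ∀ k, k < p.K → ∀ (t : SeqOfRecord F θ.ν θ.τ9.M (gOfRecord₁₃ F N θ.toStage13Params p) p.K k → Sect2.TermValues (F.P p.K) (MatA N) (FluctV N) θ.τ9.M)
        (Ek : SeqOfRecord F θ.ν θ.τ9.M (gOfRecord₁₃ F N θ.toStage13Params p) p.K k → ℝ),
        HasSect2FormAtZS F N (FluctV N) p.K (settingOfRecord₁₃ F N θ.toStage13Params p) k (θ.rzAt p) (WtOfRecord₁₃H F N θ p)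
          (UbgOfRecord₁₃CoP F N θ.toStage13Params p k)
          (fun s u => Sect2.LawsRT (sect2TowerOfRecord F N (FluctV N) p.K (settingOfRecord₁₃ F N θ.toStage13Params p) (θ.rzAt p s) s u)
            (settingOfRecord₁₃ F N θ.toStage13Params p).lf k)
          (slotsOfRecord F N θ.ν θ.τ9 (EOfRecord₁₃ F N θ.toStage13Params) (wOfRecord₉ F N θ.toStage9Params) θ.ppSel p (gOfRecord₁₃ F N θ.toStage13Params p) k) t Ek →
        (∀ s₀, IsFluctLocal k (t s₀)) →
        ∀ s : SeqOfRecord F θ.ν θ.τ9.M (gOfRecord₁₃ F N θ.toStage13Params p) p.K (k + 1), s.Ω (k + 1) = ∅ →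
          slotsOfRecord F N θ.ν θ.τ9 (EOfRecord₁₃ F N θ.toStage13Params) (wOfRecord₉ F N θ.toStage9Params) θ.ppSel p (gOfRecord₁₃ F N θ.toStage13Params p) k s.init ≠ 0 →
          ∀ S ∈ admSOfRecord F θ.ν θ.τ9.M (gOfRecord₁₃ F N θ.toStage13Params p) p.K k s.init,
            Measurable (fun ω : MultiCfg (F.P p.K) (SU N) (FluctV N) =>
              sect2Operand F N (FluctV N) p.K (settingOfRecord₁₃ F N θ.toStage13Params p) (θ.rzAt p s.init) s.init (t s.init) (Ek s.init)
                  (UbgOfRecord₁₃CoP F N θ.toStage13Params p k s.init) (S, fun j => (ω j).2) (fun j => (ω j).1)) ∧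
            ∃ CΦ : ℝ, ∀ a U, sect2Operand F N (FluctV N) p.K (settingOfRecord₁₃ F N θ.toStage13Params p) (θ.rzAt p s.init) s.init (t s.init) (Ek s.init)
                  (UbgOfRecord₁₃CoP F N θ.toStage13Params p k s.init) a U ≤ CΦ)
    (hsup : ∀ k, k < p.K → Sect3SupplyAt θ p k) :
    ∀ k, k ≤ p.K → SLaw₁₃CoPH F N θ p k :=
  sLaw₁₃CoPH_all_of_tStep_of_supply_of_liveSel θ p h hsel hθ hκ hE₀ hB₀ hM
    (fun k hk => noExpansionTStepAt_of_gaussCert_of_operandRows_at_present_parents θ p hζ hq h hk hM (hops k hk)) hsup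


/-- **★★★ THEOREM 1 OF [III] AT ANY `θ` OF THE GAUSSIAN CLASS ON THE LIVE LINE, def-T's TERM ROWS + dag-n11-e's SPLICE SUPPLY ONLY** (dag-n11-w4's
`sLaw₁₃CoPH_all_of_coercive_termRows_of_spliceSupply_of_liveSel` with the whole K0b-value block — pins, measurability, coercivity — DISCHARGED for the class).
[cite: Balaban1988Convergent, Thm 1 p.262, Theorem p.245, p.244, (3.24)–(3.25) p.270, §3 p.279; Balaban1989LargeFieldI, (0.2)–(0.4) p.176, p.177 (i)–(ii)] -/
theorem sLaw₁₃CoPH_all_of_gaussCert_of_termRows_of_spliceSupply_of_liveSel (hζ : ∀ (p : B12.RunParams) (n : ℕ) (Ω Λ : ℕ → Set (Site (F.P p.K) 0)), (θ.Zh p n Ω Λ).ζ0 = (ZhPinOfRecord₁₃ θ.toStage13Params p Ω Λ).ζ0)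
    (hq : ∀ (p : B12.RunParams) (n : ℕ) (Ω Λ : ℕ → Set (Site (F.P p.K) 0)) (j : ℕ) (Λ' : Set (Site (F.P p.K) 0)) (ω : MultiCfg (F.P p.K) (SU N) (FluctV N)),
      (θ.Zh p n Ω Λ).quad j Λ' ω = ∑ b ∈ (Set.toFinite (bondsIn j (Λ'ᶜ ∩ Ω (j + 1)))).toFinset, ‖(ω j).2 b‖ ^ 2)
    (h : θ.Provisos₁₃CoPH F N)
    (hsel : θ.ppSel = ppSelLiveOfRecord F N θ.ν θ.τ9 (EOfRecord₁₃ F N θ.toStage13Params) (wOfRecord₉ F N θ.toStage9Params))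
    (hθ : θ.Admissible F N) (hκ : 0 ≤ θ.s2.lf.κ) (hE₀ : 0 ≤ θ.s2.lf.E₀) (hB₀ : 0 ≤ θ.s2.lf.B₀) (hM : 1 ≤ θ.τ9.M)
    (hterm : ∀ k, k < p.K → ∀ (t : SeqOfRecord F θ.ν θ.τ9.M (gOfRecord₁₃ F N θ.toStage13Params p) p.K k → Sect2.TermValues (F.P p.K) (MatA N) (FluctV N) θ.τ9.M)
        (Ek : SeqOfRecord F θ.ν θ.τ9.M (gOfRecord₁₃ F N θ.toStage13Params p) p.K k → ℝ),
        HasSect2FormAtZS F N (FluctV N) p.K (settingOfRecord₁₃ F N θ.toStage13Params p) k (θ.rzAt p) (WtOfRecord₁₃H F N θ p)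
          (UbgOfRecord₁₃CoP F N θ.toStage13Params p k)
          (fun s u => Sect2.LawsRT (sect2TowerOfRecord F N (FluctV N) p.K (settingOfRecord₁₃ F N θ.toStage13Params p) (θ.rzAt p s) s u)
            (settingOfRecord₁₃ F N θ.toStage13Params p).lf k)
          (slotsOfRecord F N θ.ν θ.τ9 (EOfRecord₁₃ F N θ.toStage13Params) (wOfRecord₉ F N θ.toStage9Params) θ.ppSel p (gOfRecord₁₃ F N θ.toStage13Params p) k) t Ek →
        (∀ s₀, IsFluctLocal k (t s₀)) →
        ∀ s : SeqOfRecord F θ.ν θ.τ9.M (gOfRecord₁₃ F N θ.toStage13Params p) p.K (k + 1), s.Ω (k + 1) = ∅ →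
          slotsOfRecord F N θ.ν θ.τ9 (EOfRecord₁₃ F N θ.toStage13Params) (wOfRecord₉ F N θ.toStage9Params) θ.ppSel p (gOfRecord₁₃ F N θ.toStage13Params p) k s.init ≠ 0 →
          (∀ (j : ℕ) (X : (Sect2.domSys (F.P p.K) θ.τ9.M j).Dom) (z : Site (F.P p.K) j) (g' : ℝ),
            Measurable (fun U : GaugeField (F.P p.K) 0 (SU N) => ((t s.init).E j X z g' (Sect2.ofBackgroundC (settingOfRecord₁₃ F N θ.toStage13Params p).ι U)).re)) ∧
          (∀ (j : ℕ) (X : (Sect2.domSys (F.P p.K) θ.τ9.M j).Dom),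
            Measurable (fun U : GaugeField (F.P p.K) 0 (SU N) => ((t s.init).R j X (Sect2.ofBackgroundC (settingOfRecord₁₃ F N θ.toStage13Params p).ι U)).re)) ∧
          (∀ (S' : ℕ → Set (Site (F.P p.K) 0)) (j : ℕ) (X : (Sect2.domSys (F.P p.K) θ.τ9.M j).Dom),
            Measurable (fun q : GaugeField (F.P p.K) 0 (SU N) × MSFluct (F.P p.K) (FluctV N) =>
              ((t s.init).B j X (Sect2.ofBackgroundC (settingOfRecord₁₃ F N θ.toStage13Params p).ι q.1) (S', q.2)).re)) ∧
          (∃ CE : ℝ, ∀ (j : ℕ) (X : (Sect2.domSys (F.P p.K) θ.τ9.M j).Dom) (z : Site (F.P p.K) j) (g' : ℝ) (U : GaugeField (F.P p.K) 0 (SU N)),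
            |((t s.init).E j X z g' (Sect2.ofBackgroundC (settingOfRecord₁₃ F N θ.toStage13Params p).ι U)).re| ≤ CE) ∧
          (∃ CR : ℝ, ∀ (j : ℕ) (X : (Sect2.domSys (F.P p.K) θ.τ9.M j).Dom) (U : GaugeField (F.P p.K) 0 (SU N)),
            |((t s.init).R j X (Sect2.ofBackgroundC (settingOfRecord₁₃ F N θ.toStage13Params p).ι U)).re| ≤ CR) ∧
          (∃ CB : ℝ, ∀ (j : ℕ) (X : (Sect2.domSys (F.P p.K) θ.τ9.M j).Dom) (U : GaugeField (F.P p.K) 0 (SU N)) (a : Tk.SFluct (F.P p.K) (FluctV N)),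
            |((t s.init).B j X (Sect2.ofBackgroundC (settingOfRecord₁₃ F N θ.toStage13Params p).ι U) a).re| ≤ CB))
    (hsup : ∀ k, k < p.K → BalabanUVNodesN11Sect3SupplySpliceDefs.Sect3SpliceSupplyAt θ p k) :
    ∀ k, k ≤ p.K → SLaw₁₃CoPH F N θ p k :=
  BalabanUVNodesN11Sect3SupplySplice.sLaw₁₃CoPH_all_of_tStep_of_spliceSupply_of_liveSel θ p h hsel hθ hκ hE₀ hB₀ hM
    (fun k hk => noExpansionTStepAt_of_gaussCert_of_termRows_at_present_parents θ p hζ hq h hk hM (hterm k hk)) hsup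

/-- **★★★ THEOREM 1 OF [III] AT ANY GAUSSIAN-CLASS H-EXTENSION `⟨⟨theta13LiveOfRecord, Zr⟩, Zh, Phih⟩` OF THE WITNESS OF RECORD** (`Zh` with the certificate's `ζ0` and the
A-fibre Gaussian `quad` — e.g. the Gaussian certificate of the history-blind door of the cured witness), ALL LEVELS, ALL HISTORIES — FROM (per level, at the no-expansion histories
with a PRESENT parent only) def-T's OPERAND ROWS + [III] §3's SUPPLY, AND NOTHING ELSE (the core provisos `hrec` of the extension are the datum's key: at the history-blind door they
are `Node00.provisos₁₃CoPH_door_theta13LiveOfRecord`, and the Gaussian certificate of that door keeps them — `…GaussianCertificateRows.exists_gaussCert_of_antecedent`).  dag-n11-e's §5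
(`sLaw₁₃CoPH_all_theta13LiveOfRecordH_of_tStep_of_supply`; 𝐑-side CLOSED there).  The Gaussian twin of dag-n11-e's `sLaw₁₃CoPH_all_rePinH_doorCured_theta13LiveOfRecord_of_dominated_rows_of_supply`
with the (K0b) rows GONE — THE HONEST STATE OF N11 AT A GAUSSIAN DOOR after dag-n11-d g10∕g11, dag-n11-e g14∕g15, dag-n11-w4 and this seat's g0.
[cite: Balaban1988Convergent, Thm 1 p.262, Theorem p.245, p.244, (3.24)–(3.25) p.270, (3.23) p.270, (1.11) p.248, (3.16)–(3.22) pp.268–269; Balaban1989LargeFieldI, (0.3)–(0.4) p.176, p.177 (i)–(ii)] -/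
theorem sLaw₁₃CoPH_all_gaussCertH_doorCured_theta13LiveOfRecord_of_operandRows_of_supply
    {Zr : (p : B12.RunParams) → TkResidualW F N (FluctV N) p.K}
    {Zh : (p : B12.RunParams) → ℕ → (ℕ → Set (Site (F.P p.K) 0)) → (ℕ → Set (Site (F.P p.K) 0)) → TkResidualW F N (FluctV N) p.K}
    {Phih : (p : B12.RunParams) → ℕ → (ℕ → Set (Site (F.P p.K) 0)) → (ℕ → Set (Site (F.P p.K) 0)) → (ℕ → Plaq (F.P p.K) 0 → ℝ)}
    (hζ : ∀ (p : B12.RunParams) (n : ℕ) (Ω Λ : ℕ → Set (Site (F.P p.K) 0)), (Zh p n Ω Λ).ζ0 = (ZhPinOfRecord₁₃ (theta13LiveOfRecord F N) p Ω Λ).ζ0)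
    (hq : ∀ (p : B12.RunParams) (n : ℕ) (Ω Λ : ℕ → Set (Site (F.P p.K) 0)) (j : ℕ) (Λ' : Set (Site (F.P p.K) 0)) (ω : MultiCfg (F.P p.K) (SU N) (FluctV N)),
      (Zh p n Ω Λ).quad j Λ' ω = ∑ b ∈ (Set.toFinite (bondsIn j (Λ'ᶜ ∩ Ω (j + 1)))).toFinset, ‖(ω j).2 b‖ ^ 2)
    (hrec : (⟨⟨theta13LiveOfRecord F N, Zr⟩, Zh, Phih⟩ : Stage13HParams F N).Provisos₁₃CoPH F N)
    (hops : ∀ k, k < p.K → ∀ (t : SeqOfRecord F (theta13LiveOfRecord F N).ν (theta13LiveOfRecord F N).τ9.M (gOfRecord₁₃ F N (theta13LiveOfRecord F N) p) p.K k →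
          Sect2.TermValues (F.P p.K) (MatA N) (FluctV N) (theta13LiveOfRecord F N).τ9.M)
        (Ek : SeqOfRecord F (theta13LiveOfRecord F N).ν (theta13LiveOfRecord F N).τ9.M (gOfRecord₁₃ F N (theta13LiveOfRecord F N) p) p.K k → ℝ),
        HasSect2FormAtZS F N (FluctV N) p.K (settingOfRecord₁₃ F N (theta13LiveOfRecord F N) p) k ((⟨⟨theta13LiveOfRecord F N, Zr⟩, Zh, Phih⟩ : Stage13HParams F N).rzAt p) (WtOfRecord₁₃H F N (⟨⟨theta13LiveOfRecord F N, Zr⟩, Zh, Phih⟩ : Stage13HParams F N) p)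
          (UbgOfRecord₁₃CoP F N (theta13LiveOfRecord F N) p k)
          (fun s u => Sect2.LawsRT (sect2TowerOfRecord F N (FluctV N) p.K (settingOfRecord₁₃ F N (theta13LiveOfRecord F N) p) ((⟨⟨theta13LiveOfRecord F N, Zr⟩, Zh, Phih⟩ : Stage13HParams F N).rzAt p s) s u)
            (settingOfRecord₁₃ F N (theta13LiveOfRecord F N) p).lf k)
          (slotsOfRecord F N (theta13LiveOfRecord F N).ν (theta13LiveOfRecord F N).τ9 (EOfRecord₁₃ F N (theta13LiveOfRecord F N))
            (wOfRecord₉ F N (theta13LiveOfRecord F N).toStage9Params) (theta13LiveOfRecord F N).ppSel p (gOfRecord₁₃ F N (theta13LiveOfRecord F N) p) k) t Ek →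
        (∀ s₀, IsFluctLocal k (t s₀)) →
        ∀ s : SeqOfRecord F (theta13LiveOfRecord F N).ν (theta13LiveOfRecord F N).τ9.M (gOfRecord₁₃ F N (theta13LiveOfRecord F N) p) p.K (k + 1), s.Ω (k + 1) = ∅ →
          slotsOfRecord F N (theta13LiveOfRecord F N).ν (theta13LiveOfRecord F N).τ9 (EOfRecord₁₃ F N (theta13LiveOfRecord F N))
              (wOfRecord₉ F N (theta13LiveOfRecord F N).toStage9Params) (theta13LiveOfRecord F N).ppSel p (gOfRecord₁₃ F N (theta13LiveOfRecord F N) p) k s.init ≠ 0 →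
          ∀ S ∈ admSOfRecord F (theta13LiveOfRecord F N).ν (theta13LiveOfRecord F N).τ9.M (gOfRecord₁₃ F N (theta13LiveOfRecord F N) p) p.K k s.init,
            Measurable (fun ω : MultiCfg (F.P p.K) (SU N) (FluctV N) =>
              sect2Operand F N (FluctV N) p.K (settingOfRecord₁₃ F N (theta13LiveOfRecord F N) p) ((⟨⟨theta13LiveOfRecord F N, Zr⟩, Zh, Phih⟩ : Stage13HParams F N).rzAt p s.init) s.init (t s.init) (Ek s.init)
                (UbgOfRecord₁₃CoP F N (theta13LiveOfRecord F N) p k s.init) (S, fun j => (ω j).2) (fun j => (ω j).1)) ∧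
            ∃ CΦ : ℝ, ∀ a U, sect2Operand F N (FluctV N) p.K (settingOfRecord₁₃ F N (theta13LiveOfRecord F N) p) ((⟨⟨theta13LiveOfRecord F N, Zr⟩, Zh, Phih⟩ : Stage13HParams F N).rzAt p s.init) s.init (t s.init) (Ek s.init)
                (UbgOfRecord₁₃CoP F N (theta13LiveOfRecord F N) p k s.init) a U ≤ CΦ)
    (hsup : ∀ k, k < p.K → Sect3SupplyAt (⟨⟨theta13LiveOfRecord F N, Zr⟩, Zh, Phih⟩ : Stage13HParams F N) p k) :
    ∀ k, k ≤ p.K → SLaw₁₃CoPH F N (⟨⟨theta13LiveOfRecord F N, Zr⟩, Zh, Phih⟩ : Stage13HParams F N) p k :=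
  sLaw₁₃CoPH_all_theta13LiveOfRecordH_of_tStep_of_supply F N _ _ _ p
    (fun k hk => noExpansionTStepAt_of_gaussCert_of_operandRows_at_present_parents (⟨⟨theta13LiveOfRecord F N, Zr⟩, Zh, Phih⟩ : Stage13HParams F N) p hζ hq hrec hk (le_of_eq rfl) (hops k hk)) hsup

end Summit.QuantumFields.YangMills.Theorems.BalabanUVNodesN11NoExpansionTStepAtGaussCert

end
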